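/-
COR-CM (cell pub-hodgecm2, stage 2 of the Hodge ladder) — count-neutral KERNEL COMBINATORICS «the index-two cyclic law» (modular ∪ semidihedral
columns), part III: THE DESCENT TO THE ARC PAIRS (seat prover-pub-hodgecm2-b23-g49-0, binder prover b23, gen 49; claim «INDEX-TWO CYCLIC LAW»,
HOME/INBOX.md l.22678).  Theorems only, on parts I/II (`Census/IndexTwoCyclicDatum.lean`, `Census/IndexTwoCyclicArcPairs.lean`) and on seat b23
gen 38ʼs cyclic boundary descent (`CyclicFaces.bd`, `CyclicBoundary.pot`, `CyclicBoundary.exists_places`, `CyclicFaces.bd_oflipCM`, …: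
`Census/CyclicTypeBoundary.lean`, `Census/CyclicBoundary*.lean`) and seat b09ʼs potential descent (`TwistGeneration.descent`:
`Census/TwistGenerationDescent.lean`), all BY NAME — this is seat b23 gen 48ʼs `Census/DihedralDescent.lean` transposed from the dihedral twist
`r = −1` to an arbitrary twist `r` (the only change: the coset boundary of a rotation translate moves by `rk` instead of `−k`); no `decide`, no
certificate, no named fact, no `sorry`; `Interfaces.lean` (C1), every E term, B01, `Transposition/*`, `PortJoin/*`, `D2Bridge/*` untouched.
HONEST FRAMING: `HC_CM` is NOT proved, here or anywhere in the tree; nothing here is a period, a count of record or a headline.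
T5: n/a-class (hypothesis binders = the fields of `IndexTwoCyclic.Datum`; checker: self).
-/
import Summits.HodgeConjecture.CorCM.Census.IndexTwoCyclicArcPairs
import Summits.HodgeConjecture.CorCM.Census.TwistGenerationDescent

/-!
# The index-two cyclic law, III: every type descends to the arc pairs

THE SETTING of parts I/II: an index-two cyclic datum `D` for `(G, c)` (`G ≅ ℤ/2n ⋊_r ℤ/2`, `c = uⁿ`, involution `w`, `w·u = uʳ·w`).  The
ROTATION BOUNDARY of a type `Ψ` is seat b23 gen 38ʼs boundary set `bd c u n Ψ ⊂ ℤ/n` of the rotation part `{i ∣ uⁱ ∈ Ψ}` along `u`; the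
COSET BOUNDARY is the rotation boundary of the base change `Ψ·w` (whose rotation part is the coset part of `Ψ`).  The two-sided potential
`POT(Ψ) = pot (bd Ψ) + pot (bd (Ψ·w))` is a BLOCK INVARIANT for every twist `r` (§1: a rotation `uᵏ` translates the rotation boundary by `−k`
and the coset boundary by `−rk`, `w` swaps them).

* §2 THE COORDINATE FACE: through every type whose rotation boundary is not a singleton, gen 38ʼs `exists_places` gives two ROTATION places whose
  face lowers `pot ∘ bd` at its three other corners (`exists_gface_pow`) — and flipping rotation places does not touch the coset boundary
  (`bd_rt_w_oflipCM_pow`), so the face lowers `POT`.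
* §3 SINGLETON BOUNDARIES ARE ARCS: a type both of whose boundaries are singletons is an arc pair `A(a, b)` of part II (`exists_biArc_of_card_bd`).
* §4 **THE DESCENT** (`exists_faces_descent_to_biArcs`): there is a family `S₁` of face relations, ONE per block not consisting of arc pairs
  (`|S₁| ≤ #{blocks without arc pairs}`), such that every integer vector is congruent modulo `ℤ⟨base changes of S₁⟩` to a vector supported on arc
  pairs — b09ʼs `TwistGeneration.descent` with the potential `POT` and the coordinate faces at a representative of each block, translated.
Part V finishes: the arc faces are the unit squares of the torus `(ℤ/2n)²`; one per arc block other than the block of `A(0,0)` generates them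
all, and the Hodge vectors on the half cross `{A(a,0)} ∪ {A(0,b)}` (`a, b ≤ n`) are multiples of a pair (part IV).

## References
* [Pohlmann1968] H. Pohlmann, Algebraic cycles on abelian varieties of complex multiplication type, Ann. of Math. 88 (1968), Thm 1.
* [Milne1999] J. S. Milne, Lefschetz motives and the Tate conjecture, Compositio Math. 117 (1999), Prop. 2.1, p. 54.
-/

namespace Summit.HodgeConjecture.CorCM.Census.IndexTwoCyclic

open Finset
open scoped symmDiff
open Summit.HodgeConjecture.CorCM.Prior.AllgGroup.RfwfAllgGroup
open Summit.HodgeConjecture.CorCM.Census.BlockParity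
open Summit.HodgeConjecture.CorCM.Census.CyclicBoundary
open Summit.HodgeConjecture.CorCM.Census.CyclicFaces
open Summit.HodgeConjecture.CorCM.Census.Dihedral (val_add_n inArc_add_n inArc_sub_iff inArc_add_iff val_lt_iff_not_iff)

noncomputable section

variable {G : Type*} [Group G] [Fintype G] [DecidableEq G] {c : G} {n : ℕ} [NeZero n]
variable (D : Datum G c n)

/-! ## §1 The two-sided potential is a block invariant -/

/-- **Rotations translate the rotation boundary**: `bd (Ψ·u⁻ᵏ) = bd Ψ − k`. [folklore] -/
theorem bd_rt_pow (k : ℕ) (Ψ : CMF G c) :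
    bd c D.u n (rt c (D.u ^ k) Ψ) = (bd c D.u n Ψ).image fun y => y + -(k : ZMod n) := by
  induction k generalizing Ψ with
  | zero =>
    rw [pow_zero, rt_one, Nat.cast_zero, neg_zero]
    have e : (fun y : ZMod n => y + 0) = id := funext fun y => add_zero y
    rw [e, Finset.image_id]
  | succ k ih =>
    rw [pow_succ, rt_mul, ih (rt c D.u Ψ), bd_rt_gen c D.u D.hun, Finset.image_image]
    congr 1
    funext y
    simp only [Function.comp_apply]
    push_cast
    ring

/-- The potential of the rotation boundary is invariant under rotations. [folklore] -/
theorem pot_bd_rt_pow (k : ℕ) (Ψ : CMF G c) : pot (bd c D.u n (rt c (D.u ^ k) Ψ)) = pot (bd c D.u n Ψ) := by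
  rw [bd_rt_pow, pot_shift]

/-- The cardinality of the rotation boundary is invariant under rotations. [folklore] -/
theorem card_bd_rt_pow (k : ℕ) (Ψ : CMF G c) : (bd c D.u n (rt c (D.u ^ k) Ψ)).card = (bd c D.u n Ψ).card := by
  rw [bd_rt_pow, Finset.card_image_of_injective _ (add_left_injective _)]

omit [NeZero n] in
/-- `(Ψ·u⁻ᵏ)·w = (Ψ·w)·u^{-rk}`: the coset part of a rotation translate is the `r`-twisted translate of the coset part. [folklore] -/
theorem rt_w_rt_pow (k : ℕ) (Ψ : CMF G c) : rt c D.w (rt c (D.u ^ k) Ψ) = rt c (D.u ^ (D.r * k)) (rt c D.w Ψ) := by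
  rw [← rt_mul, D.w_mul_pow, rt_mul]

omit [NeZero n] in
/-- `(Ψ·w)·w = Ψ`. [folklore] -/
theorem rt_w_rt_w (Ψ : CMF G c) : rt c D.w (rt c D.w Ψ) = Ψ := by rw [← rt_mul, D.hww, rt_one]

/-- **`POT` is invariant under rotations.** [folklore] -/
theorem POT_rt_pow (k : ℕ) (Ψ : CMF G c) :
    pot (bd c D.u n (rt c (D.u ^ k) Ψ)) + pot (bd c D.u n (rt c D.w (rt c (D.u ^ k) Ψ))) =
      pot (bd c D.u n Ψ) + pot (bd c D.u n (rt c D.w Ψ)) := by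
  rw [pot_bd_rt_pow, rt_w_rt_pow, pot_bd_rt_pow]

/-- **`POT` is invariant under `w`** (the two boundaries swap). [folklore] -/
theorem POT_rt_w (Ψ : CMF G c) :
    pot (bd c D.u n (rt c D.w Ψ)) + pot (bd c D.u n (rt c D.w (rt c D.w Ψ))) = pot (bd c D.u n Ψ) + pot (bd c D.u n (rt c D.w Ψ)) := by
  rw [rt_w_rt_w, add_comm]

/-- **`POT` is a block invariant**: invariant under every base change. [folklore] -/
theorem POT_rt (Q : G) (Ψ : CMF G c) :
    pot (bd c D.u n (rt c Q Ψ)) + pot (bd c D.u n (rt c D.w (rt c Q Ψ))) = pot (bd c D.u n Ψ) + pot (bd c D.u n (rt c D.w Ψ)) := by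
  obtain ⟨k, -, rfl | rfl⟩ := D.exists_pow_or_pow_mul_w Q
  · exact POT_rt_pow D k Ψ
  · rw [rt_mul, POT_rt_pow, POT_rt_w]

/-- The two boundary cardinalities are block invariants (as an unordered pair): rotations. [folklore] -/
theorem card_bd_pair_rt_pow (k : ℕ) (Ψ : CMF G c) :
    (bd c D.u n (rt c (D.u ^ k) Ψ)).card = (bd c D.u n Ψ).card ∧
      (bd c D.u n (rt c D.w (rt c (D.u ^ k) Ψ))).card = (bd c D.u n (rt c D.w Ψ)).card := by
  rw [card_bd_rt_pow, rt_w_rt_pow, card_bd_rt_pow]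
  exact ⟨rfl, rfl⟩

/-! ## §2 The coordinate face -/

/-- **Gen 38ʼs descending face with its places made explicit**: through a type whose rotation boundary is not a singleton there are two rotation
places `u^p`, `u^q` whose face lowers `pot ∘ bd` at the three other corners. [folklore] -/
theorem exists_gface_pow (hc2 : c * c = 1) (Ψ : CMF G c) (h1 : (bd c D.u n Ψ).card ≠ 1) :
    ∃ p q : ℕ, D.u ^ q ∉ orb c (D.u ^ p) ∧
      pot (bd c D.u n (oflipCM c hc2 (D.u ^ p) Ψ)) < pot (bd c D.u n Ψ) ∧
      pot (bd c D.u n (oflipCM c hc2 (D.u ^ q) Ψ)) < pot (bd c D.u n Ψ) ∧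
      pot (bd c D.u n (oflipCM c hc2 (D.u ^ p) (oflipCM c hc2 (D.u ^ q) Ψ))) < pot (bd c D.u n Ψ) := by
  have h3 := three_le_card_bd c D.u D.hun Ψ h1
  have hn : 2 ≤ n := le_trans (by norm_num) (three_le_of_card h3)
  obtain ⟨p, q, hpq, hp, hq, hpq'⟩ := exists_places (bd c D.u n Ψ) h3
  have hbp := bd_oflipCM c D.u D.hun hc2 D.hord hn p.val
  have hbq := bd_oflipCM c D.u D.hun hc2 D.hord hn q.val
  simp only [ZMod.natCast_zmod_val] at hbp hbq
  refine ⟨p.val, q.val, ?_, ?_, ?_, ?_⟩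
  · rw [pow_mem_orb_iff c D.u D.hun hc2 D.hord, ZMod.natCast_zmod_val, ZMod.natCast_zmod_val]
    exact fun h => hpq h.symm
  · rw [hbp]; exact hp
  · rw [hbq]; exact hq
  · rw [hbp, hbq, symmDiff_right_comm]; exact hpq'

/-- **Flipping a coset place does not change the rotation boundary.** [folklore] -/
theorem bd_oflipCM_pow_mul_w (hc2 : c * c = 1) (p : ℕ) (Φ : CMF G c) :
    bd c D.u n (oflipCM c hc2 (D.u ^ p * D.w) Φ) = bd c D.u n Φ := by
  ext k
  rw [mem_bd_iff, mem_bd_iff, CyclicFaces.mem_oflipCM_iff, CyclicFaces.mem_oflipCM_iff]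
  have h1 := pow_notMem_orb_pow_mul_w D k.val p
  have h2 := pow_notMem_orb_pow_mul_w D (k.val + 1) p
  tauto

/-- **Flipping a rotation place does not change the coset boundary**: `bd ((Ψ^{(u^p)})·w) = bd (Ψ·w)`. [folklore] -/
theorem bd_rt_w_oflipCM_pow (hc2 : c * c = 1) (p : ℕ) (Ψ : CMF G c) :
    bd c D.u n (rt c D.w (oflipCM c hc2 (D.u ^ p) Ψ)) = bd c D.u n (rt c D.w Ψ) := by
  rw [rt_oflipCM, D.w_inv, bd_oflipCM_pow_mul_w]

/-- **THE COORDINATE FACE LOWERS `POT`**: through a type whose rotation boundary is not a singleton there is a face relation whose three other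
corners have smaller two-sided potential. [folklore] -/
theorem exists_gface_POT (hc2 : c * c = 1) (Ψ : CMF G c) (h1 : (bd c D.u n Ψ).card ≠ 1) :
    ∃ t t' : G, t' ∉ orb c t ∧
      pot (bd c D.u n (oflipCM c hc2 t Ψ)) + pot (bd c D.u n (rt c D.w (oflipCM c hc2 t Ψ))) <
          pot (bd c D.u n Ψ) + pot (bd c D.u n (rt c D.w Ψ)) ∧
      pot (bd c D.u n (oflipCM c hc2 t' Ψ)) + pot (bd c D.u n (rt c D.w (oflipCM c hc2 t' Ψ))) <
          pot (bd c D.u n Ψ) + pot (bd c D.u n (rt c D.w Ψ)) ∧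
      pot (bd c D.u n (oflipCM c hc2 t (oflipCM c hc2 t' Ψ))) + pot (bd c D.u n (rt c D.w (oflipCM c hc2 t (oflipCM c hc2 t' Ψ)))) <
          pot (bd c D.u n Ψ) + pot (bd c D.u n (rt c D.w Ψ)) := by
  obtain ⟨p, q, hpq, hp, hq, hpq'⟩ := exists_gface_pow D hc2 Ψ h1
  refine ⟨D.u ^ p, D.u ^ q, hpq, ?_, ?_, ?_⟩
  · rw [bd_rt_w_oflipCM_pow]; omega
  · rw [bd_rt_w_oflipCM_pow]; omega
  · rw [bd_rt_w_oflipCM_pow, bd_rt_w_oflipCM_pow]; omega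

/-! ## §3 Singleton boundaries are arcs -/

/-- Consecutive exponents off the boundary have the same membership. [folklore] -/
theorem pow_mem_iff_succ_of_notMem (Ψ : CMF G c) {j : ℕ} (hj : ((j : ℕ) : ZMod n) ∉ bd c D.u n Ψ) :
    D.u ^ j ∈ Ψ.1 ↔ D.u ^ (j + 1) ∈ Ψ.1 := by
  rw [mem_bd_natCast c D.u D.hun] at hj
  tauto

/-- **A singleton rotation boundary is an arc**: if `bd Ψ = {k₀}` then the rotation part of `Ψ` is the arc `(a, a+n]` for `a = k₀.val` or
`a = k₀.val + n`. [folklore] -/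
theorem exists_arc_of_card_bd_eq_one (Ψ : CMF G c) (h : (bd c D.u n Ψ).card = 1) :
    ∃ a : ZMod (2 * n), ∀ i : ℕ, D.u ^ i ∈ Ψ.1 ↔ ((i : ZMod (2 * n)) - a - 1).val < n := by
  have hn : 1 ≤ n := Nat.one_le_iff_ne_zero.mpr (NeZero.ne n)
  obtain ⟨k₀, hk₀⟩ := Finset.card_eq_one.mp h
  -- the run: membership is constant on `k₀.val + 1, …, k₀.val + n`
  have hrun : ∀ t : ℕ, t < n → (D.u ^ (k₀.val + 1 + t) ∈ Ψ.1 ↔ D.u ^ (k₀.val + 1) ∈ Ψ.1) := by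
    intro t ht
    induction t with
    | zero => rfl
    | succ t ih =>
      have ih' := ih (by omega)
      rw [← ih', show k₀.val + 1 + (t + 1) = (k₀.val + 1 + t) + 1 by ring]
      symm
      apply pow_mem_iff_succ_of_notMem D Ψ
      rw [hk₀, Finset.mem_singleton]
      intro e
      have e' : (((1 + t : ℕ) : ZMod n)) = 0 := by
        have : ((k₀.val + 1 + t : ℕ) : ZMod n) = k₀ + ((1 + t : ℕ) : ZMod n) := by push_cast; rw [ZMod.natCast_zmod_val]; ring
        rw [this] at e
        simpa using e
      rw [ZMod.natCast_eq_zero_iff] at e'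
      exact absurd (Nat.le_of_dvd (by omega) e') (by omega)
  -- membership at `k₀.val + 1 + t` for all `t < 2n`
  have hflip : ∀ j : ℕ, D.u ^ (j + n) ∈ Ψ.1 ↔ D.u ^ j ∉ Ψ.1 := pow_add_n_mem_iff c D.u D.hun Ψ
  set ε : Prop := D.u ^ (k₀.val + 1) ∈ Ψ.1 with hε
  by_cases hE : ε
  · refine ⟨(k₀.val : ZMod (2 * n)), fun i => ?_⟩
    -- write `i ≡ k₀.val + 1 + t (mod 2n)` with `t < 2n`
    set t : ℕ := ((i : ZMod (2 * n)) - k₀.val - 1).val with ht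
    have hlt : t < 2 * n := ZMod.val_lt _
    have hi : D.u ^ i = D.u ^ (k₀.val + 1 + t) := by
      rw [D.pow_eq_pow_iff]; push_cast; rw [ht, ZMod.natCast_zmod_val]; ring
    rw [hi]
    by_cases htn : t < n
    · rw [hrun t htn]; exact ⟨fun _ => htn, fun _ => hE⟩
    · have e : k₀.val + 1 + t = (k₀.val + 1 + (t - n)) + n := by omega
      rw [e, hflip, hrun (t - n) (by omega)]
      constructor
      · intro h'; exact absurd hE h'
      · intro h'; omega
  · refine ⟨(k₀.val : ZMod (2 * n)) + n, fun i => ?_⟩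
    set t : ℕ := ((i : ZMod (2 * n)) - k₀.val - 1).val with ht
    have hlt : t < 2 * n := ZMod.val_lt _
    have hi : D.u ^ i = D.u ^ (k₀.val + 1 + t) := by
      rw [D.pow_eq_pow_iff]; push_cast; rw [ht, ZMod.natCast_zmod_val]; ring
    have hval : (((i : ZMod (2 * n)) - ((k₀.val : ZMod (2 * n)) + n) - 1)).val = ((t : ZMod (2 * n)) + n).val := by
      congr 1
      have e : ((t : ZMod (2 * n))) = (i : ZMod (2 * n)) - k₀.val - 1 := by rw [ht, ZMod.natCast_zmod_val]
      rw [e]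
      have h2 : (n : ZMod (2 * n)) + n = 0 := by rw [← Nat.cast_add, ← two_mul, ZMod.natCast_self]
      linear_combination (-1 : ZMod (2 * n)) * h2
    rw [hi, hval, val_add_n hn, ZMod.val_natCast, Nat.mod_eq_of_lt hlt]
    by_cases htn : t < n
    · rw [hrun t htn, if_pos htn]
      constructor
      · intro h'; exact absurd h' hE
      · intro h'; omega
    · have e : k₀.val + 1 + t = (k₀.val + 1 + (t - n)) + n := by omega
      rw [e, hflip, hrun (t - n) (by omega), if_neg htn]
      constructor
      · intro _; omega
      · intro _; exact hE

/-- **A type whose two boundaries are singletons is an arc pair.** [folklore] -/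
theorem exists_biArc_of_card_bd (Ψ : CMF G c) (h1 : (bd c D.u n Ψ).card = 1) (h2 : (bd c D.u n (rt c D.w Ψ)).card = 1) :
    ∃ a b : ZMod (2 * n), Ψ = biArc D a b := by
  obtain ⟨a, ha⟩ := exists_arc_of_card_bd_eq_one D Ψ h1
  obtain ⟨b, hb⟩ := exists_arc_of_card_bd_eq_one D (rt c D.w Ψ) h2
  refine ⟨a, b, eq_of_forall_pow_mem_iff D (fun i _ => ?_) (fun i _ => ?_)⟩
  · rw [ha, pow_mem_biArc]
  · rw [← mem_rt, hb, pow_mul_w_mem_biArc]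

/-- Being an arc pair is a block invariant. [folklore] -/
theorem exists_biArc_rt_iff (Q : G) (Ψ : CMF G c) :
    (∃ a b : ZMod (2 * n), rt c Q Ψ = biArc D a b) ↔ ∃ a b : ZMod (2 * n), Ψ = biArc D a b := by
  constructor
  · rintro ⟨a, b, h⟩
    have e : Ψ = rt c Q⁻¹ (biArc D a b) := by rw [← h, rt_inv_rt]
    obtain ⟨a', b', -, h'⟩ := rt_biArc D a b Q⁻¹
    exact ⟨a', b', by rw [e, h']⟩
  · rintro ⟨a, b, rfl⟩
    obtain ⟨a', b', -, h'⟩ := rt_biArc D a b Q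
    exact ⟨a', b', h'⟩

/-! ## §4 The descent to the arc pairs -/

/-- **In a block without arc pairs some member has a non-singleton rotation boundary** (the representative or its `w`-translate). [folklore] -/
theorem exists_rep_card_bd_ne_one (B : Block c) (hB : ¬ ∃ a b : ZMod (2 * n), B.out = biArc D a b) :
    ∃ Φ : CMF G c, blk c Φ = B ∧ (bd c D.u n Φ).card ≠ 1 := by
  by_cases h1 : (bd c D.u n B.out).card = 1
  · refine ⟨rt c D.w B.out, by rw [blk_rt]; exact Quotient.out_eq B, fun h2 => hB ?_⟩
    exact exists_biArc_of_card_bd D B.out h1 h2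
  · exact ⟨B.out, Quotient.out_eq B, h1⟩

/-- **THE DESCENT TO THE ARC PAIRS.**  There is a family `S₁` of face relations, at most one per block containing no arc pair, such that every
integer vector is congruent modulo `ℤ⟨base changes of S₁⟩` to a vector supported on arc pairs. [folklore] -/
theorem exists_faces_descent_to_biArcs (hc2 : c * c = 1) :
    ∃ S₁ : Finset (CMF G c →₀ ℤ), (↑S₁ ⊆ gfaceSet G c hc2) ∧
      S₁.card ≤ (univ.filter fun B : Block c => ¬ ∃ a b : ZMod (2 * n), B.out = biArc D a b).card ∧
      ∀ y : CMF G c →₀ ℤ, ∃ y' : CMF G c →₀ ℤ, y - y' ∈ Submodule.span ℤ (translates c S₁) ∧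
        ∀ Ψ ∈ y'.support, ∃ a b : ZMod (2 * n), Ψ = biArc D a b := by
  classical
  -- a representative with non-singleton rotation boundary and its coordinate face, for every block without arc pairs
  have hrep : ∀ B : Block c, ∃ Φ : CMF G c, ∃ t t' : G, (¬ ∃ a b : ZMod (2 * n), B.out = biArc D a b) →
      (blk c Φ = B ∧ t' ∉ orb c t ∧
        pot (bd c D.u n (oflipCM c hc2 t Φ)) + pot (bd c D.u n (rt c D.w (oflipCM c hc2 t Φ))) <
            pot (bd c D.u n Φ) + pot (bd c D.u n (rt c D.w Φ)) ∧
        pot (bd c D.u n (oflipCM c hc2 t' Φ)) + pot (bd c D.u n (rt c D.w (oflipCM c hc2 t' Φ))) <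
            pot (bd c D.u n Φ) + pot (bd c D.u n (rt c D.w Φ)) ∧
        pot (bd c D.u n (oflipCM c hc2 t (oflipCM c hc2 t' Φ))) + pot (bd c D.u n (rt c D.w (oflipCM c hc2 t (oflipCM c hc2 t' Φ)))) <
            pot (bd c D.u n Φ) + pot (bd c D.u n (rt c D.w Φ))) := by
    intro B
    by_cases hB : ∃ a b : ZMod (2 * n), B.out = biArc D a b
    · exact ⟨B.out, 1, 1, fun h => absurd hB h⟩
    · obtain ⟨Φ, hΦ, h1⟩ := exists_rep_card_bd_ne_one D B hB
      obtain ⟨t, t', htt', h₁, h₂, h₃⟩ := exists_gface_POT D hc2 Φ h1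
      exact ⟨Φ, t, t', fun _ => ⟨hΦ, htt', h₁, h₂, h₃⟩⟩
  choose Φ t t' hspec using hrep
  set bad : Finset (Block c) := univ.filter fun B : Block c => ¬ ∃ a b : ZMod (2 * n), B.out = biArc D a b with hbad
  set S₁ : Finset (CMF G c →₀ ℤ) := bad.image fun B => gface c hc2 (Φ B) (t B) (t' B) with hS₁
  refine ⟨S₁, ?_, Finset.card_image_le, fun y => ?_⟩
  · intro f hf
    obtain ⟨B, hB, rfl⟩ := Finset.mem_image.mp (Finset.mem_coe.mp hf)
    exact ⟨Φ B, t B, t' B, (hspec B (Finset.mem_filter.mp hB).2).2.1, rfl⟩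
  · refine TwistGeneration.descent c (fun Ψ => pot (bd c D.u n Ψ) + pot (bd c D.u n (rt c D.w Ψ)))
      (fun Ψ => ∃ a b : ZMod (2 * n), Ψ = biArc D a b) hc2 (Submodule.span ℤ (translates c S₁)) (fun Ψ hΨ => ?_) y
    -- the block of `Ψ` has no arc pair; translate its coordinate face to `Ψ`
    set B := blk c Ψ with hBdef
    have hB : ¬ ∃ a b : ZMod (2 * n), B.out = biArc D a b := by
      intro h
      obtain ⟨Q, hQ⟩ := exists_rt_eq_of_blk_eq c (show blk c B.out = blk c Ψ by rw [hBdef]; exact Quotient.out_eq _)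
      apply hΨ
      rw [← hQ]
      exact (exists_biArc_rt_iff D Q B.out).mpr h
    have hBbad : B ∈ bad := Finset.mem_filter.mpr ⟨Finset.mem_univ _, hB⟩
    obtain ⟨hΦblk, -, h₁, h₂, h₃⟩ := hspec B hB
    obtain ⟨Q, hQ⟩ := exists_rt_eq_of_blk_eq c (show blk c (Φ B) = blk c Ψ from hΦblk)
    refine ⟨t B * Q⁻¹, t' B * Q⁻¹, ?_, ?_, ?_, ?_⟩
    · have hmem : Finsupp.mapDomain (rt c Q) (gface c hc2 (Φ B) (t B) (t' B)) ∈ translates c S₁ :=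
        ⟨Q, _, Finset.mem_image.mpr ⟨B, hBbad, rfl⟩, rfl⟩
      rw [mapDomain_rt_gface, hQ] at hmem
      exact Submodule.subset_span hmem
    · rw [← hQ, ← rt_oflipCM, POT_rt, POT_rt]; exact h₁
    · rw [← hQ, ← rt_oflipCM, POT_rt, POT_rt]; exact h₂
    · rw [← hQ, ← rt_oflipCM, ← rt_oflipCM, POT_rt, POT_rt]; exact h₃

end

end Summit.HodgeConjecture.CorCM.Census.IndexTwoCyclic
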